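import Summits.QuantumFields.YangMills.Theorems.PoincareLipschitzHierAlignStep
import Literature.MathematicalPhysics.QuantumFieldTheory.Balaban1983to89.T4AvgSensitivity
import Literature.MathematicalPhysics.QuantumFieldTheory.Balaban1983to89.B7SectAStatements
import HarnessLib

/-!
# Crux stmt-QuantumFields-19936 `HistoryTailL` — THE HIERARCHICAL ALIGNMENT, ALL LEVELS («ALIGN-TOWER»):
# Bałaban's `n`-level axial gauge with the AVERAGES as coarse variables — fine relative deviation ≤ Σ over the heights of the local
# curvatures + the deviation of the TOP averaged bond in a free top gauge

Cell `ym3-torus` (YM ladder rung R3 = continuum SU(2) Yang–Mills on the three-torus — a RUNG, NOT the Clay problem; not d = 4, not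
infinite volume, not a mass gap), width seat `ym-ust-19936-w3` gen 12, `--supports stmt-QuantumFields-19936 --as helper`.  LEAD
★w1-19936 g7 word 01:07:50Z «ALIGN GO».  The one-level step ✓`PoincareLipschitzHierAlignStep.exists_rootedBlockAxialGauge_SU` says: for a
fine `SU(N)` configuration `W` and a coarse gauge `h` there is a fine gauge `u` (block-axial, rooted in `h`) with
`dist1 ((W^u) b) ≤ 2((d+2)L)²·a + dist1 ((W̄^h) ⟨blockOf b₋, dir b⟩)` whenever the fine plaquettes based within coarse distance `2d` of
`blockOf b₋` are `< a` (guard `(((d+2)L)²∕4)·a < δ_N`).  THIS FILE iterates it down a tower of `n` averagings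
`V ↦ Ū^{(1)} ↦ … ↦ Ū^{(n)}` (`T4AvgSensitivity.iterFrom` of the averaging of record `blockAvg expMeanLogSU`, from ANY level `k`), peeling the
TOP level in the induction so that no gauge covariance is ever needed (each level's gauge is built from the UNGAUGED average and the next
level's gauge):

★★★ `exists_hierAxialGauge` — for `k + n ≤ m + K`, every `V : GaugeField P k SU(N)` and every TOP gauge `hTop : GaugeTransf P (k+n) SU(N)`
there is a fine gauge `u` such that for every fine bond `b` and every profile `a : ℕ → ℝ≥0` with the guards `(((d+2)L)²∕4)·a i < δ_N`: if
for every height `i < n` the plaquettes of `Ū^{(i)} = iterFrom i V` based within coarse torus distance `2d` of the block tower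
`blockOfIter (i+1) b₋` are `< a i`, then
`dist1 ((V^u) b) ≤ 2((d+2)L)²·Σ_{i<n} a i + dist1 (((Ū^{(n)})^{hTop}) ⟨blockOfIter n b₋, dir b⟩)`
— [Balaban1985Averaging] §C (64)–(68) («a sequence of axial gauge conditions in blocks of lattices Ω, Ω⁽¹⁾, …, Ω⁽ᵏ⁻¹⁾» with the averages
(65)∕(68) as the coarse variables), the top gauge left FREE as in the tree's straight-transport precedent
✓`T4MultilevelCombGauge.multilevel_bound`.  With the crux's hierarchical windows `a i := θBal(K−i)`-class and the summable thresholds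
✓`PoincareLipschitzThresholdSums.sum_θBal_le` this is the j-UNIFORM sup-chart of the K2 deep regime (companion «ALIGN-T3»).

THEOREMS ONLY, def-free; nothing of h⋆, F5∕F6, `BlockLipschitzL`, the stubs of any registered line, the crux `HistoryTailL` or a summit
statement is proved here.
-/

noncomputable section

open scoped BigOperators

namespace Summit.QuantumFields.YangMills.Theorems.PoincareLipschitzHierAlignTower

open Literature.MathematicalPhysics.QuantumFieldTheory.Balaban1983to89
open T4Continuum BlockAveraging ExpMeanLog T4AvgSensitivity
open B7SectAStatements (blockOfIter blockOfIter_zero blockOfIter_succ)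
open Summit.QuantumFields.YangMills.Theorems.PoincareLipschitzHierAlignStep (exists_rootedBlockAxialGauge_SU)
open scoped Matrix.Norms.L2Operator

variable {n : Type*} [Fintype n] [DecidableEq n] [Nonempty n] {P : Params}

/-- ★★★ **THE HIERARCHICAL AXIAL GAUGE (ALIGN-TOWER).**  For a tower of `N` averagings of record from level `k` (`k + N ≤ m + K`), every
`SU(N)` configuration `V` of `T^{(k)}` and every gauge `hTop` of the top torus `T^{(k+N)}`, there is a gauge `u` of `T^{(k)}` such that for
every fine bond `b` and every profile of local curvature bounds `a i` (guards `(((d+2)L)²∕4)·a i < δ_N`): if at every height `i < N` the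
plaquettes of `Ū^{(i)} = iterFrom i V` based in blocks within coarse torus distance `2d` of the block tower `blockOfIter (i+1) b₋` are
within `a i` of `1`, then `dist1 ((V^u) b) ≤ 2((d+2)L)²·Σ_{i<N} a i + dist1 (((Ū^{(N)})^{hTop}) ⟨blockOfIter N b₋, dir b⟩)`.
[cite: Balaban1985Averaging, (64)-(68) p.29; Balaban1987RG1, (0.3)-(0.4) pp.252-253] -/
theorem exists_hierAxialGauge (k : ℕ) :
    ∀ (N : ℕ), k + N ≤ P.m + P.K →
      ∀ (V : GaugeField P k (Matrix.specialUnitaryGroup n ℂ)) (hTop : GaugeTransf P (k + N) (Matrix.specialUnitaryGroup n ℂ)),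
        ∃ u : GaugeTransf P k (Matrix.specialUnitaryGroup n ℂ),
          ∀ (b : PBond P k) (a : ℕ → ℝ), (∀ i, 0 ≤ a i) →
            (∀ i, i < N → ((((P.d + 2) * P.L : ℕ) : ℝ) ^ 2 / 4) * a i < deltaSU n) →
            (∀ (i : ℕ) (hi : i < N) (q : Plaq P (k + i)),
                Site.tdist (blockOf q.src) (blockOfIter (i + 1) b.src) ≤ 2 * P.d →
                  dist1 (GaugeField.plaqHol
                    (iterFrom (fun i' => BlockAveraging.blockAvg (P := P) (j := i') (expMeanLogSU (n := n))) k i V) q) < a i) →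
            dist1 (GaugeField.gaugeAct u V b) ≤
              2 * ((((P.d + 2) * P.L : ℕ) : ℝ) ^ 2) * (∑ i ∈ Finset.range N, a i) +
                dist1 (GaugeField.gaugeAct hTop
                  (iterFrom (fun i' => BlockAveraging.blockAvg (P := P) (j := i') (expMeanLogSU (n := n))) k N V)
                  ⟨blockOfIter N b.src, b.dir⟩)
  | 0, _, V, hTop => by
    refine ⟨hTop, fun b a _ _ _ => ?_⟩
    simp only [Finset.range_zero, Finset.sum_empty, mul_zero, zero_add, iterFrom_zero, blockOfIter_zero]
    exact le_rfl
  | N + 1, hN, V, hTop => by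
    -- the `N`-fold average `W` at level `k + N`, and the one-level step at the top with the free gauge `hTop`
    set W := iterFrom (fun i' => BlockAveraging.blockAvg (P := P) (j := i') (expMeanLogSU (n := n))) k N V with hW
    obtain ⟨h, -, hstep⟩ := exists_rootedBlockAxialGauge_SU (n := n) (j := k + N) (by omega) W hTop
    -- the tower below, rooted in `h`
    obtain ⟨u, hu⟩ := exists_hierAxialGauge k N (by omega) V h
    refine ⟨u, fun b a ha hguard hloc => ?_⟩
    have h1 := hu b a ha (fun i hi => hguard i (by omega)) (fun i hi q hq => hloc i (by omega) q hq)
    have h2 := hstep ⟨blockOfIter N b.src, b.dir⟩ (a N) (ha N) (fun q hq => hloc N (by omega) q hq) (hguard N (by omega))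
    rw [Finset.sum_range_succ, mul_add]
    have e : iterFrom (fun i' => BlockAveraging.blockAvg (P := P) (j := i') (expMeanLogSU (n := n))) k (N + 1) V =
        avgFun (expMeanLogSU (n := n)) W := by
      rw [iterFrom_succ, BlockAveraging.blockAvg_avg]
    rw [e]
    have e2 : (blockOfIter (N + 1) b.src : Site P (k + N + 1)) = blockOf (blockOfIter N b.src) := rfl
    rw [e2]
    linarith

/-- ★★★ **THE HIERARCHICAL AXIAL GAUGE FROM THE FINEST LATTICE** (the form the `T3Family` letters consume: `Averaging.iter` from level `0`, the
block tower of the bond supplied as a sequence `y` with `y 0 = b₋`, `y (i+1) = blockOf (y i)` — no iterated-block definition needed).  For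
`N ≤ m + K`, `V : GaugeField P 0 SU(N)` and a top gauge `hTop` of `T^{(N)}` there is a gauge `u` of `T^{(0)}` such that for every fine bond `b`,
every block tower `y` of `b₋` and every profile `a` with the guards: if at every height `i < N` the plaquettes of `Ū^i(V)` based in blocks within
coarse torus distance `2d` of `y (i+1)` are `< a i`, then `dist1 ((V^u) b) ≤ 2((d+2)L)²·Σ_{i<N} a i + dist1 (((Ū^N V)^{hTop}) ⟨y N, dir b⟩)`.
[cite: Balaban1985Averaging, (64)-(68) p.29; Balaban1987RG1, (0.3)-(0.4) pp.252-253] -/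
theorem exists_hierAxialGauge_zero :
    ∀ (N : ℕ), N ≤ P.m + P.K →
      ∀ (V : GaugeField P 0 (Matrix.specialUnitaryGroup n ℂ)) (hTop : GaugeTransf P N (Matrix.specialUnitaryGroup n ℂ)),
        ∃ u : GaugeTransf P 0 (Matrix.specialUnitaryGroup n ℂ),
          ∀ (b : PBond P 0) (y : (i : ℕ) → Site P i), y 0 = b.src → (∀ i, y (i + 1) = blockOf (y i)) →
            ∀ (a : ℕ → ℝ), (∀ i, 0 ≤ a i) →
            (∀ i, i < N → ((((P.d + 2) * P.L : ℕ) : ℝ) ^ 2 / 4) * a i < deltaSU n) →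
            (∀ (i : ℕ) (hi : i < N) (q : Plaq P i), Site.tdist (blockOf q.src) (y (i + 1)) ≤ 2 * P.d →
                dist1 (GaugeField.plaqHol
                  (Averaging.iter (fun i' => BlockAveraging.blockAvg (P := P) (j := i') (expMeanLogSU (n := n))) i V) q) < a i) →
            dist1 (GaugeField.gaugeAct u V b) ≤
              2 * ((((P.d + 2) * P.L : ℕ) : ℝ) ^ 2) * (∑ i ∈ Finset.range N, a i) +
                dist1 (GaugeField.gaugeAct hTop
                  (Averaging.iter (fun i' => BlockAveraging.blockAvg (P := P) (j := i') (expMeanLogSU (n := n))) N V) ⟨y N, b.dir⟩)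
  | 0, _, V, hTop => by
    refine ⟨hTop, fun b y hy0 _ a _ _ _ => ?_⟩
    simp only [Finset.range_zero, Finset.sum_empty, mul_zero, zero_add]
    have e : (⟨y 0, b.dir⟩ : PBond P 0) = b := by rw [hy0]
    rw [e]
    exact le_rfl
  | N + 1, hN, V, hTop => by
    set W := Averaging.iter (fun i' => BlockAveraging.blockAvg (P := P) (j := i') (expMeanLogSU (n := n))) N V with hW
    obtain ⟨h, -, hstep⟩ := exists_rootedBlockAxialGauge_SU (n := n) (j := N) (by omega) W hTop
    obtain ⟨u, hu⟩ := exists_hierAxialGauge_zero N (by omega) V h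
    refine ⟨u, fun b y hy0 hysucc a ha hguard hloc => ?_⟩
    have h1 := hu b y hy0 hysucc a ha (fun i hi => hguard i (by omega)) (fun i hi q hq => hloc i (by omega) q hq)
    have h2 := hstep ⟨y N, b.dir⟩ (a N) (ha N) (fun q hq => hloc N (by omega) q (by rw [hysucc N]; exact hq)) (hguard N (by omega))
    rw [Finset.sum_range_succ, mul_add]
    have e : Averaging.iter (fun i' => BlockAveraging.blockAvg (P := P) (j := i') (expMeanLogSU (n := n))) (N + 1) V =
        avgFun (expMeanLogSU (n := n)) W := rfl
    rw [e, hysucc N]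
    linarith

/-- **COROLLARY — UNIFORM PROFILE**: with one curvature bound `a i` per height on ALL plaquettes within coarse distance `2d` of the tower and a top
gauge in which every top bond near the tower is within `X` of `1`, every fine bond has `dist1 ((V^u) b) ≤ 2((d+2)L)²·Σ_{i<N} a i + X`.
[cite: Balaban1985Averaging, (64)-(68) p.29] -/
theorem exists_hierAxialGauge_le (k N : ℕ) (hN : k + N ≤ P.m + P.K) (V : GaugeField P k (Matrix.specialUnitaryGroup n ℂ))
    (hTop : GaugeTransf P (k + N) (Matrix.specialUnitaryGroup n ℂ)) (S : Set (PBond P k)) (a : ℕ → ℝ) (X : ℝ)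
    (ha : ∀ i, 0 ≤ a i) (hguard : ∀ i, i < N → ((((P.d + 2) * P.L : ℕ) : ℝ) ^ 2 / 4) * a i < deltaSU n)
    (hloc : ∀ b ∈ S, ∀ (i : ℕ) (hi : i < N) (q : Plaq P (k + i)),
      Site.tdist (blockOf q.src) (blockOfIter (i + 1) b.src) ≤ 2 * P.d →
        dist1 (GaugeField.plaqHol (iterFrom (fun i' => BlockAveraging.blockAvg (P := P) (j := i') (expMeanLogSU (n := n))) k i V) q) < a i)
    (hTopX : ∀ b ∈ S, dist1 (GaugeField.gaugeAct hTop
      (iterFrom (fun i' => BlockAveraging.blockAvg (P := P) (j := i') (expMeanLogSU (n := n))) k N V) ⟨blockOfIter N b.src, b.dir⟩) ≤ X) :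
    ∃ u : GaugeTransf P k (Matrix.specialUnitaryGroup n ℂ), ∀ b ∈ S,
      dist1 (GaugeField.gaugeAct u V b) ≤ 2 * ((((P.d + 2) * P.L : ℕ) : ℝ) ^ 2) * (∑ i ∈ Finset.range N, a i) + X := by
  obtain ⟨u, hu⟩ := exists_hierAxialGauge (n := n) k N hN V hTop
  refine ⟨u, fun b hb => ?_⟩
  have h1 := hu b a ha hguard (hloc b hb)
  have h2 := hTopX b hb
  linarith

/-- **TWO-FIELD COROLLARY (the relative sup-chart).**  If `U` and `U'` are both bond-small after gauges `u`, `u'` on a set of bonds —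
`dist1 ((U^u) b) ≤ τ`, `dist1 ((U'^{u'}) b) ≤ τ'` — then in the relative gauge `g := u⁻¹·u'` the pair is bond-close:
`dist1 ((U'^g) b · (U b)⁻¹) ≤ τ + τ'` (bi-invariance of `dist1`).  This is how the single-field hierarchical gauge yields the a-priori
per-bond chart for `W = U'^g U⁻¹` in the deep regime of the K2 supplier plan. [folklore] -/
theorem dist1_relGauge_le {j : ℕ} {G : Type*} [GaugeGroup G] (U U' : GaugeField P j G) (u u' : GaugeTransf P j G) (b : PBond P j)
    {τ τ' : ℝ} (hU : dist1 (GaugeField.gaugeAct u U b) ≤ τ) (hU' : dist1 (GaugeField.gaugeAct u' U' b) ≤ τ') :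
    dist1 (GaugeField.gaugeAct (fun x => (u x)⁻¹ * u' x) U' b * (U b)⁻¹) ≤ τ + τ' := by
  -- `(u⁻¹u') U' (u⁻¹u')⁻¹ · U⁻¹ = u⁻¹ · [ (U'^{u'}) · (U^u)⁻¹ ] · u` at the two endpoints
  have e : GaugeField.gaugeAct (fun x => (u x)⁻¹ * u' x) U' b * (U b)⁻¹ =
      (u b.src)⁻¹ * (GaugeField.gaugeAct u' U' b * (GaugeField.gaugeAct u U b)⁻¹) * (u b.src)⁻¹⁻¹ := by
    simp only [GaugeField.gaugeAct, mul_inv_rev, inv_inv]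
    group
  rw [e, GaugeGroup.dist1_conj]
  calc dist1 (GaugeField.gaugeAct u' U' b * (GaugeField.gaugeAct u U b)⁻¹)
      ≤ dist1 (GaugeField.gaugeAct u' U' b) + dist1 ((GaugeField.gaugeAct u U b)⁻¹) := GaugeGroup.dist1_mul_le _ _
    _ ≤ τ' + τ := by rw [GaugeGroup.dist1_inv]; exact add_le_add hU' hU
    _ = τ + τ' := add_comm _ _

end Summit.QuantumFields.YangMills.Theorems.PoincareLipschitzHierAlignTower

end
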